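import Summits.CriticalPhenomena.PercolationContinuityZ3.Theorems.PercNearOneGluingNoHeavyQuantFarHairyCycle
import Summits.CriticalPhenomena.PercolationContinuityZ3.Theorems.PercNearOneGluingNoHeavyQuantFarHairyCycleReachD
import HarnessLib

/-!
# FAR beyond trees: the segment reduction WITH RELAYS ON THE CYCLE (degenerate hairs)

builds on p205010 (kernel theorem, internal audit signed; external expert review pending)

Support file (`--supports stmt-CriticalPhenomena-4575`), seat `prim-cert-1` (gen 18); sequel of `…QuantFarHairyCycle` (segment reduction for
hairy cycles whose relays are pendant tips).  Here hair `k` may be DEGENERATE, `t_k = c_{b_k}`: the relay is the cycle vertex itself (the quant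
lane's rings with relays at cycle vertices AND/OR on pendant hairs).  Data `HairyCycle.IsHairyCycleD`: as `IsHairyCycle` but the
off-cycle condition is replaced by "a tip on the cycle is its own base".  In the block reading a degenerate hair has an EMPTY block, so the
corresponding sun hair is read as always open (weight `1`), and the sun graph `C_{K+1}` with `K` proper hairs still carries the law:

* `blkD`, `greadD`, `readSunD` and their lemmas (`cycE_mem_readSunD_iff`, `hairE_mem_readSunD_iff`, `hairE_mem_readSunD_of_deg`,
  `RTD_readSunD_iff`, `openConn_tip_iff_readSunD`);
* `HairyCycle.farp_of_sunD` — **FAR at layer `j` on every hairy cycle with `K` relays at cycle vertices and/or pendant tips follows from FAR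
  on the sun graph for every weight function vanishing off it** (so the certificates of `…QuantFarSunCert…` apply verbatim).
No sorries; standard axioms; nothing computational.
[cite: KozmaNitzan2024, Conjecture 3 (p. 15)] (context); [cite: Grimmett1999, §1.3 p. 10] (product measure, grouping edges into blocks).
-/

noncomputable section

namespace Summit.CriticalPhenomena.PercolationContinuityZ3.Theorems.HairyCycle

open Finset MeasureTheory
open Literature.Probability.Percolation Literature.Probability.LatticeModels
open Summit.CriticalPhenomena.PercolationContinuityZ3.Theorems.AdditiveGluing.Negative.Cert
open Summit.CriticalPhenomena.PercolationContinuityZ3.Theorems.TwoCopy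
open scoped Classical

section TransferD

variable {n : ℕ}

/-- Hairy cycle with possibly DEGENERATE hairs (`t_k = c_{b_k}`: the relay is the cycle vertex): cycle of length `L ≥ 3` injective,
bases on the cycle and monotone, tips injective, and a tip on the cycle is its own base. [this work] -/
structure IsHairyCycleD (L : ℕ) (cyc : ℕ → Fin n) (K : ℕ) (base : ℕ → ℕ) (tip : ℕ → Fin n) : Prop where
  hL : 3 ≤ L
  hK : 2 ≤ K
  hcyc : ∀ i j, i < L → j < L → cyc i = cyc j → i = j
  hbase : ∀ k, k < K → base k < L
  htip : ∀ k k', k < K → k' < K → tip k = tip k' → k = k'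
  hoff' : ∀ k i, k < K → i < L → tip k = cyc i → i = base k
  hmono : ∀ k k', k ≤ k' → k' < K → base k ≤ base k'

variable {L : ℕ} {cyc : ℕ → Fin n} {K : ℕ} {base : ℕ → ℕ} {tip : ℕ → Fin n}

/-- Cycle edges are distinct. [this work] -/
theorem cycE_injD (H : IsHairyCycleD L cyc K base tip) {i i' : ℕ} (hi : i < L) (hi' : i' < L)
    (h : cycE L cyc i = cycE L cyc i') : i = i' := by
  have hL := H.hL
  have h' : s(cyc i, cyc ((i + 1) % L)) = cycE L cyc i' := h
  rcases cycE_eq_iff L cyc H.hL H.hcyc hi (Nat.mod_lt _ (by omega)) hi' h' with ⟨h1, -⟩ | ⟨h1, h2⟩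
  · exact h1
  · exfalso
    by_cases hlt : i' + 1 < L
    · rw [Nat.mod_eq_of_lt hlt] at h1
      subst h1
      by_cases hlt2 : i' + 1 + 1 < L
      · rw [Nat.mod_eq_of_lt hlt2] at h2; omega
      · have : i' + 1 + 1 = L := by omega
        rw [this, Nat.mod_self] at h2; omega
    · have h3 : i' + 1 = L := by omega
      rw [h3, Nat.mod_self] at h1
      subst h1
      rw [Nat.mod_eq_of_lt (by omega : 0 + 1 < L)] at h2
      omega

/-- A cycle edge is not a loop. [this work] -/
theorem cycE_not_isDiagD (H : IsHairyCycleD L cyc K base tip) {i : ℕ} (hi : i < L) : ¬ (cycE L cyc i).IsDiag := by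
  have hL := H.hL
  unfold cycE
  rw [Sym2.mk_isDiag_iff]
  intro h
  have := H.hcyc _ _ hi (Nat.mod_lt _ (by omega)) h
  by_cases hlt : i + 1 < L
  · rw [Nat.mod_eq_of_lt hlt] at this; omega
  · have h3 : i + 1 = L := by omega
    rw [h3, Nat.mod_self] at this; omega

/-- A non-degenerate tip is off the cycle. [this work] -/
theorem tip_ne_cyc_of_ndeg (H : IsHairyCycleD L cyc K base tip) {k i : ℕ} (hk : k < K) (hi : i < L)
    (hnd : tip k ≠ cyc (base k)) : tip k ≠ cyc i := fun h => hnd (by rw [h, H.hoff' k i hk hi h])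

/-- Hair edges of non-degenerate hairs are distinct from all other hair edges. [this work] -/
theorem hairE_injD (H : IsHairyCycleD L cyc K base tip) {k k' : ℕ} (hk : k < K) (hk' : k' < K) (hnd : tip k ≠ cyc (base k))
    (h : hairE cyc base tip k = hairE cyc base tip k') : k = k' := by
  unfold hairE at h
  rcases Sym2.eq_iff.1 h with ⟨-, h2⟩ | ⟨h1, h2⟩
  · exact H.htip _ _ hk hk' h2
  · exfalso
    exact tip_ne_cyc_of_ndeg H hk (H.hbase k' hk') hnd h2

/-- A hair edge is not a cycle edge (`L ≥ 3`). [this work] -/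
theorem hairE_ne_cycED (H : IsHairyCycleD L cyc K base tip) {k i : ℕ} (hk : k < K) (hi : i < L) :
    hairE cyc base tip k ≠ cycE L cyc i := by
  have hL := H.hL
  intro h
  unfold hairE cycE at h
  have hi1 : (i + 1) % L < L := Nat.mod_lt _ (by omega)
  rcases Sym2.eq_iff.1 h with ⟨h1, h2⟩ | ⟨h1, h2⟩
  · have e1 := H.hcyc _ _ (H.hbase k hk) hi h1
    have e2 := H.hoff' k _ hk hi1 h2
    have e3 : (i + 1) % L = i := e2.trans e1
    by_cases hlt : i + 1 < L
    · rw [Nat.mod_eq_of_lt hlt] at e3; omega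
    · have h3 : i + 1 = L := by omega
      rw [h3, Nat.mod_self] at e3; omega
  · have e1 := H.hcyc _ _ (H.hbase k hk) hi1 h1
    have e2 := H.hoff' k _ hk hi h2
    have e3 : (i + 1) % L = i := (e2.trans e1).symm
    by_cases hlt : i + 1 < L
    · rw [Nat.mod_eq_of_lt hlt] at e3; omega
    · have h3 : i + 1 = L := by omega
      rw [h3, Nat.mod_self] at e3; omega

/-! ## The block reading, degenerate hairs having empty blocks -/
variable (L cyc K base tip)

/-- The block of a pair: the sun cycle edge of its segment (cycle edges), the sun hair (edges of NON-degenerate hairs), a loop otherwise. [this work] -/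
def blkD (e : Sym2 (Fin n)) : Sym2 (Fin (2 * K + 1)) :=
  if h : ∃ m, m < L ∧ e = cycE L cyc m then cycE (K + 1) (sunCyc K) (seg K base (Classical.choose h))
  else if h' : ∃ k, k < K ∧ tip k ≠ cyc (base k) ∧ e = hairE cyc base tip k then
    hairE (sunCyc K) sunBase (sunTip K) (Classical.choose h')
  else s(0, 0)

/-- The block events. [this work] -/
def greadD (j : Sym2 (Fin (2 * K + 1))) (ω : Set (Sym2 (Fin n))) : Prop :=
  j ∈ Eset (sunEs K) ∧ ∀ e, blkD L cyc K base tip e = j → e ∈ ω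

/-- The reading map. [this work] -/
def readSunD (ω : Set (Sym2 (Fin n))) : Set (Sym2 (Fin (2 * K + 1))) := {j | greadD L cyc K base tip j ω}

/-- The reading is block-local. [this work] -/
theorem greadD_isBlockLocal : IsBlockLocal (blkD L cyc K base tip) (greadD L cyc K base tip) := by
  intro j ω ω' hagree
  unfold greadD
  exact and_congr Iff.rfl (forall_congr' fun e => imp_congr_right fun he => hagree e he)

/-- The reading is carried by the sun graph. [this work] -/
theorem readSunD_carried (ω : Set (Sym2 (Fin n))) :
    Carried (K + 1) (sunCyc K) K sunBase (sunTip K) (readSunD L cyc K base tip ω) := by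
  intro u v _ huv
  have hmem : s(u, v) ∈ Eset (sunEs K) := huv.1
  exact (mem_Eset_sunEs_iff K _).1 hmem

variable {L cyc K base tip}

/-- The block of a cycle edge. [this work] -/
theorem blkD_cycE (H : IsHairyCycleD L cyc K base tip) {m : ℕ} (hm : m < L) :
    blkD L cyc K base tip (cycE L cyc m) = cycE (K + 1) (sunCyc K) (seg K base m) := by
  have hex : ∃ m', m' < L ∧ cycE L cyc m = cycE L cyc m' := ⟨m, hm, rfl⟩
  unfold blkD
  rw [dif_pos hex]
  have := Classical.choose_spec hex
  rw [← cycE_injD H hm this.1 this.2]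

/-- The block of a non-degenerate hair edge. [this work] -/
theorem blkD_hairE (H : IsHairyCycleD L cyc K base tip) {k : ℕ} (hk : k < K) (hnd : tip k ≠ cyc (base k)) :
    blkD L cyc K base tip (hairE cyc base tip k) = hairE (sunCyc K) sunBase (sunTip K) k := by
  have hnex : ¬ ∃ m, m < L ∧ hairE cyc base tip k = cycE L cyc m := fun ⟨m, hm, h⟩ => hairE_ne_cycED H hk hm h
  have hex : ∃ k', k' < K ∧ tip k' ≠ cyc (base k') ∧ hairE cyc base tip k = hairE cyc base tip k' := ⟨k, hk, hnd, rfl⟩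
  unfold blkD
  rw [dif_neg hnex, dif_pos hex]
  obtain ⟨hk', hnd', heq⟩ := Classical.choose_spec hex
  rw [← hairE_injD H hk hk' hnd heq]

/-- A sun cycle edge is open in the reading iff every cycle edge of its segment is open. [this work] -/
theorem cycE_mem_readSunD_iff (H : IsHairyCycleD L cyc K base tip) (ω : Set (Sym2 (Fin n))) {i : ℕ} (hi : i < K + 1) :
    cycE (K + 1) (sunCyc K) i ∈ readSunD L cyc K base tip ω ↔ ∀ m, m < L → seg K base m = i → cycE L cyc m ∈ ω := by
  have HS := isHairyCycle_sun H.hK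
  have hmemE : cycE (K + 1) (sunCyc K) i ∈ Eset (sunEs K) := (mem_Eset_sunEs_iff K _).2 (Or.inl ⟨i, hi, rfl⟩)
  unfold readSunD greadD
  rw [Set.mem_setOf_eq]
  constructor
  · rintro ⟨-, h⟩ m hm hseg
    exact h _ (by rw [blkD_cycE H hm, hseg])
  · intro h
    refine ⟨hmemE, fun e he => ?_⟩
    unfold blkD at he
    split_ifs at he with h1 h2
    · obtain ⟨hm, heq⟩ := Classical.choose_spec h1
      have hseg := cycE_inj HS (lt_of_le_of_lt (seg_le K base _) (Nat.lt_succ_self K)) hi he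
      rw [heq]
      exact h _ hm hseg
    · exfalso
      obtain ⟨hk, -, -⟩ := Classical.choose_spec h2
      exact hairE_ne_cycE HS hk hi he
    · exfalso
      have h0 : (s((0 : Fin (2 * K + 1)), 0)).IsDiag := Sym2.mk_isDiag_iff.2 rfl
      rw [he] at h0
      exact cycE_not_isDiag HS hi h0

/-- A sun hair of a NON-degenerate hair is open in the reading iff the hair is open. [this work] -/
theorem hairE_mem_readSunD_iff (H : IsHairyCycleD L cyc K base tip) (ω : Set (Sym2 (Fin n))) {k : ℕ} (hk : k < K)
    (hnd : tip k ≠ cyc (base k)) :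
    hairE (sunCyc K) sunBase (sunTip K) k ∈ readSunD L cyc K base tip ω ↔ hairE cyc base tip k ∈ ω := by
  have HS := isHairyCycle_sun H.hK
  have hmemE : hairE (sunCyc K) sunBase (sunTip K) k ∈ Eset (sunEs K) := (mem_Eset_sunEs_iff K _).2 (Or.inr ⟨k, hk, rfl⟩)
  unfold readSunD greadD
  rw [Set.mem_setOf_eq]
  constructor
  · rintro ⟨-, h⟩
    exact h _ (blkD_hairE H hk hnd)
  · intro h
    refine ⟨hmemE, fun e he => ?_⟩
    unfold blkD at he
    split_ifs at he with h1 h2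
    · exfalso
      exact hairE_ne_cycE HS hk (lt_of_le_of_lt (seg_le K base _) (Nat.lt_succ_self K)) he.symm
    · obtain ⟨hk', -, heq⟩ := Classical.choose_spec h2
      have := hairE_inj HS hk' hk he
      rw [heq, this]
      exact h
    · exfalso
      have h0 : (s((0 : Fin (2 * K + 1)), 0)).IsDiag := Sym2.mk_isDiag_iff.2 rfl
      rw [he] at h0
      exact hairE_not_isDiag HS hk h0

/-- The sun hair of a DEGENERATE hair is always open in the reading (empty block). [this work] -/
theorem hairE_mem_readSunD_of_deg (H : IsHairyCycleD L cyc K base tip) (ω : Set (Sym2 (Fin n))) {k : ℕ} (hk : k < K)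
    (hdeg : tip k = cyc (base k)) :
    hairE (sunCyc K) sunBase (sunTip K) k ∈ readSunD L cyc K base tip ω := by
  have HS := isHairyCycle_sun H.hK
  have hmemE : hairE (sunCyc K) sunBase (sunTip K) k ∈ Eset (sunEs K) := (mem_Eset_sunEs_iff K _).2 (Or.inr ⟨k, hk, rfl⟩)
  unfold readSunD greadD
  rw [Set.mem_setOf_eq]
  refine ⟨hmemE, fun e he => ?_⟩
  exfalso
  unfold blkD at he
  split_ifs at he with h1 h2
  · exact hairE_ne_cycE HS hk (lt_of_le_of_lt (seg_le K base _) (Nat.lt_succ_self K)) he.symm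
  · obtain ⟨hk', hnd', -⟩ := Classical.choose_spec h2
    have := hairE_inj HS hk' hk he
    rw [this] at hnd'
    exact hnd' hdeg
  · have h0 : (s((0 : Fin (2 * K + 1)), 0)).IsDiag := Sym2.mk_isDiag_iff.2 rfl
    rw [he] at h0
    exact hairE_not_isDiag HS hk h0

/-- **The arcs agree** (degenerate hairs allowed). [this work] -/
theorem RTD_readSunD_iff (H : IsHairyCycleD L cyc K base tip) (ω : Set (Sym2 (Fin n))) {k : ℕ} (hk : k < K) :
    RT (K + 1) (sunCyc K) sunBase (sunTip K) (readSunD L cyc K base tip ω) k ↔ RTD L cyc base tip ω k := by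
  have hbk := H.hbase k hk
  have hmono := H.hmono
  unfold RT RTD RC CW CCW
  refine and_congr (or_congr ?_ ?_) ?_
  · unfold sunBase
    constructor
    · intro h m hm
      have hseg : seg K base m ≤ k := (seg_le_iff hmono hk).2 hm
      exact (cycE_mem_readSunD_iff H ω (by omega)).1 (h _ (by omega)) m (by omega) rfl
    · intro h i hi
      refine (cycE_mem_readSunD_iff H ω (by omega)).2 fun m hm hseg => h m ?_
      exact (seg_le_iff hmono hk).1 (by omega)
  · unfold sunBase
    constructor
    · intro h m hm hmL
      have hseg : ¬ seg K base m ≤ k := fun h' => by have := (seg_le_iff hmono hk).1 h'; omega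
      have hsK := seg_le K base m
      exact (cycE_mem_readSunD_iff H ω (by omega)).1 (h _ (by omega) (by omega)) m hmL rfl
    · intro h i hi hiK
      refine (cycE_mem_readSunD_iff H ω hiK).2 fun m hm hseg => h m ?_ hm
      by_contra hlt
      push Not at hlt
      have := (seg_le_iff hmono hk).2 hlt
      omega
  · by_cases hdeg : tip k = cyc (base k)
    · exact ⟨fun _ => Or.inl hdeg, fun _ => hairE_mem_readSunD_of_deg H ω hk hdeg⟩
    · rw [hairE_mem_readSunD_iff H ω hk hdeg]
      exact ⟨fun h => Or.inr h, fun h => h.resolve_left hdeg⟩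

/-- **Tips agree** (degenerate hairs allowed): on a carried configuration, `o ↔ t_k` iff `0 ↔` sun tip `k` in the reading. [this work] -/
theorem openConn_tip_iff_readSunD (H : IsHairyCycleD L cyc K base tip) (ω : Set (Sym2 (Fin n)))
    (hω : Carried L cyc K base tip ω) {k : ℕ} (hk : k < K) :
    ω ∈ openConn (cyc 0) (tip k) ↔ readSunD L cyc K base tip ω ∈ openConn (sunCyc K 0) (sunTip K k) := by
  have HS := isHairyCycle_sun H.hK
  rw [mem_openConn_tip_iffD L cyc K base tip H.hL H.hcyc H.hbase H.htip H.hoff' ω hω hk,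
    mem_openConn_tip_iff (K + 1) (sunCyc K) K sunBase (sunTip K) HS.hL HS.hcyc HS.hbase HS.htip HS.hoff _
      (readSunD_carried L cyc K base tip ω) hk,
    RTD_readSunD_iff H ω hk]

/-! ## The reduction -/
/-- **SEGMENT REDUCTION, relays on the cycle allowed.**  FAR at layer `j` on every hairy cycle with `K` relays (at cycle vertices = degenerate
hairs, and/or pendant tips) follows from FAR at layer `j` on the sun graph `sun K` for every weight function vanishing off it. [this work] -/
theorem farp_of_sunD (H : IsHairyCycleD L cyc K base tip) (j : ℕ)
    (hsun : ∀ q : Sym2 (Fin (2 * K + 1)) → unitInterval, VanishesOff q (sunEs K) →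
      FARp q ((Finset.range K).image (sunTip K)) (sunCyc K 0) j)
    (w : Sym2 (Fin n) → unitInterval)
    (hsupp : ∀ e : Sym2 (Fin n), ¬ e.IsDiag → w e ≠ 0 →
      (∃ i, i < L ∧ e = cycE L cyc i) ∨ (∃ k, k < K ∧ e = hairE cyc base tip k)) :
    FARp w ((Finset.range K).image tip) (cyc 0) j := by
  set μ := prodBernoulli w with hμ
  set A : Finset (Fin n) := (Finset.range K).image tip with hA
  set A' : Finset (Fin (2 * K + 1)) := (Finset.range K).image (sunTip K) with hA'
  have hmeasB : ∀ S : Set (BondConfig (Fin n)), MeasurableSet S := fun S => (Set.toFinite S).measurableSet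
  -- good configurations have full measure
  set G : Set (BondConfig (Fin n)) := {ω | ∀ e ∈ ω, w e ≠ 0} with hG
  have hGnull : μ.real Gᶜ = 0 := by
    set Z : Finset (Sym2 (Fin n)) := univ.filter (fun e => w e = 0) with hZ
    have hsub : Gᶜ ⊆ {ω : Set (Sym2 (Fin n)) | ∃ e ∈ Z, e ∈ ω} := by
      intro ω hω
      have hω' : ¬ ∀ e ∈ ω, w e ≠ 0 := hω
      push Not at hω'
      obtain ⟨e, he, hwe⟩ := hω'
      exact ⟨e, Finset.mem_filter.2 ⟨Finset.mem_univ _, hwe⟩, he⟩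
    have h1 : μ.real {ω : Set (Sym2 (Fin n)) | ∃ e ∈ Z, e ∈ ω} ≤ ∑ e ∈ Z, (w e : ℝ) :=
      prodBernoulli_real_exists_mem_le_sum w Z
    have h2 : ∑ e ∈ Z, (w e : ℝ) = 0 := Finset.sum_eq_zero fun e he => by
      rw [Finset.mem_filter] at he
      simp [he.2]
    exact le_antisymm ((measureReal_mono hsub (measure_ne_top _ _)).trans (h1.trans h2.le)) measureReal_nonneg
  have hcongr : ∀ X Y : Set (BondConfig (Fin n)), (∀ ω ∈ G, ω ∈ X ↔ ω ∈ Y) → μ.real X = μ.real Y := by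
    have key : ∀ X Y : Set (BondConfig (Fin n)), (∀ ω ∈ G, ω ∈ X → ω ∈ Y) → μ.real X ≤ μ.real Y := by
      intro X Y h
      have hsub : X ⊆ Y ∪ Gᶜ := fun ω hω => by
        by_cases hωG : ω ∈ G
        · exact Or.inl (h ω hωG hω)
        · exact Or.inr hωG
      calc μ.real X ≤ μ.real (Y ∪ Gᶜ) := measureReal_mono hsub (measure_ne_top _ _)
        _ ≤ μ.real Y + μ.real Gᶜ := measureReal_union_le _ _
        _ = μ.real Y := by rw [hGnull, add_zero]
    intro X Y h
    exact le_antisymm (key X Y fun ω hω => (h ω hω).1) (key Y X fun ω hω => (h ω hω).2)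
  -- good configurations are carried by the hairy cycle
  have hgood : ∀ ω ∈ G, Carried L cyc K base tip ω := by
    intro ω hω u v huv he
    exact hsupp _ (fun hd => huv (Sym2.mk_isDiag_iff.1 hd)) (hω _ he)
  -- the reading and its law
  set R := readSunD L cyc K base tip with hR
  set q : Sym2 (Fin (2 * K + 1)) → unitInterval := fun e =>
    ⟨μ.real {ω | greadD L cyc K base tip e ω}, measureReal_nonneg, measureReal_le_one⟩ with hq
  have hq' : ∀ e, μ.real {ω | greadD L cyc K base tip e ω} = q e := fun e => rfl
  have hread : ∀ S : Set (Set (Sym2 (Fin (2 * K + 1)))), μ.real (R ⁻¹' S) = (prodBernoulli q).real S := fun S =>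
    prodBernoulli_real_preimage_readBlocks w (blkD L cyc K base tip) (greadD_isBlockLocal L cyc K base tip)
      (fun e => Measurable.of_discrete) q hq' MeasurableSet.of_discrete
  -- `q` vanishes off the sun graph
  have hvan : VanishesOff q (sunEs K) := by
    intro e _ he
    have hempty : {ω : Set (Sym2 (Fin n)) | greadD L cyc K base tip e ω} = ∅ :=
      Set.eq_empty_iff_forall_notMem.2 fun ω hω => he hω.1
    apply Subtype.ext
    show μ.real {ω | greadD L cyc K base tip e ω} = 0
    rw [hempty, measureReal_empty]
  -- marginals agree
  have hmarg : ∀ k, k < K → μ.real (openConn (cyc 0) (tip k)) = (prodBernoulli q).real (openConn (sunCyc K 0) (sunTip K k)) := by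
    intro k hk
    rw [← hread]
    exact hcongr _ _ fun ω hω => openConn_tip_iff_readSunD H ω (hgood ω hω) hk
  -- the relay counts agree
  have hcount : ∀ ω ∈ G, (A.filter fun a => ω ∈ openConn (cyc 0) a).card =
      (A'.filter fun a' => R ω ∈ openConn (sunCyc K 0) a').card := by
    intro ω hω
    rw [hA, hA', Finset.filter_image, Finset.filter_image,
      Finset.card_image_of_injOn (fun k hk k' hk' h => H.htip k k' (Finset.mem_range.1 (Finset.mem_filter.1 hk).1)
        (Finset.mem_range.1 (Finset.mem_filter.1 hk').1) h),
      Finset.card_image_of_injOn (fun k hk k' hk' h => sunTip_inj K k k' (Finset.mem_range.1 (Finset.mem_filter.1 hk).1)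
        (Finset.mem_range.1 (Finset.mem_filter.1 hk').1) h)]
    congr 1
    refine Finset.filter_congr fun k hk => ?_
    exact openConn_tip_iff_readSunD H ω (hgood ω hω) (Finset.mem_range.1 hk)
  have hlayer : μ.real {ω : BondConfig (Fin n) | (A.filter fun a => ω ∈ openConn (cyc 0) a).card ≤ j} =
      (prodBernoulli q).real {ω' | (A'.filter fun a' => ω' ∈ openConn (sunCyc K 0) a').card ≤ j} := by
    rw [← hread]
    exact hcongr _ _ fun ω hω => by
      simp only [Set.mem_setOf_eq, Set.mem_preimage, hcount ω hω]
  -- sums over the relay sets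
  have hsumA : ∑ a ∈ A, μ.real (openConn (cyc 0) a) = ∑ k ∈ Finset.range K, μ.real (openConn (cyc 0) (tip k)) := by
    rw [hA, Finset.sum_image]
    exact fun k hk k' hk' h => H.htip k k' (Finset.mem_range.1 hk) (Finset.mem_range.1 hk') h
  have hsumA' : ∑ a' ∈ A', (prodBernoulli q).real (openConn (sunCyc K 0) a') =
      ∑ k ∈ Finset.range K, (prodBernoulli q).real (openConn (sunCyc K 0) (sunTip K k)) := by
    rw [hA', Finset.sum_image]
    exact fun k hk k' hk' h => sunTip_inj K k k' (Finset.mem_range.1 hk) (Finset.mem_range.1 hk') h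
  -- transfer
  intro hEN t hcut
  have hEN' : (2 * j : ℝ) < ∑ a' ∈ A', (prodBernoulli q).real (openConn (sunCyc K 0) a') := by
    rw [hsumA', ← Finset.sum_congr rfl fun k hk => hmarg k (Finset.mem_range.1 hk), ← hsumA]
    exact hEN
  have hcut' : ∀ a' ∈ A', (prodBernoulli q).real (openConn (sunCyc K 0) a')ᶜ ≤ t := by
    intro a' ha'
    rw [hA', Finset.mem_image] at ha'
    obtain ⟨k, hk, rfl⟩ := ha'
    have hkK := Finset.mem_range.1 hk
    rw [probReal_compl_eq_one_sub MeasurableSet.of_discrete, ← hmarg k hkK, ← probReal_compl_eq_one_sub (hmeasB _)]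
    exact hcut (tip k) (by rw [hA]; exact Finset.mem_image_of_mem _ hk)
  have := hsun q hvan hEN' t hcut'
  rw [← hlayer] at this
  exact this

end TransferD

end Summit.CriticalPhenomena.PercolationContinuityZ3.Theorems.HairyCycle

end
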